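import Summits.Ventures.CertifiedArithmetic.LowPrec.DoubleRoundingSqrtUnderflow

/-!
# Below the underflow clause of the square root, III: the depth is attained (LAW N-sqrt-U′)

HONEST FRAMING: certified error envelopes and provably optimal rounding/accumulation schemes for
low-precision formats under stated cost models; every table by two implementations; no hardware or
vendor claims.

Sharpness half of `DoubleRoundingSqrtUnderflow.lean` (THEOREM D-sqrt-U′: depth `d ≥ m_φ + 3`
suffices — the first disjunct `emin₂ ≤ emin₁ - p₁ - 2` of [Roux2014, Table II], whose
optimality remarks concern the precision only; the optimality IN THE EXPONENT below is this
packet's). §4: a root just below a midpoint `μ` of `φ` on the finest grid of `ψ`, certified by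
the two strict inequalities `(μ - quantum_ψ/2)² < a < μ²` (`not_drSqrt_of_fine_mid_below`), and
the record-generic failure family `μ = (2^(m+2) - 1) 2^g quantum_φ/2`,
`a = μ² - 4^g quantum_φ²/4`, which fires whenever `g + d ≤ m + 2` (`not_drSqrt_low_strip`). §5:
the bias form (`not_drSqrt_of_shallow`: on the grid iff `bias_φ ≤ 2g + 2`), the exact threshold
`DRSqrt φ ψ ↔ d ≥ m_φ + 3` for sources of bias `≤ 2` (`drSqrt_iff_deep`), and the boolean tests
`drSqrtShallowTest` / `drSqrtShallowAny` with soundness, used by the toy table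
(`DoubleRoundingSqrtUnderflowTable.lean`). [this packet; cite: Figueroa1995; Roux2014, Thm 25]
-/

namespace Summit.Ventures.CertifiedArithmetic

open Literature.ComputerArithmetic.FloatingPoint
open Literature.ComputerArithmetic.FloatingPoint.Format
open Literature.ComputerArithmetic.FloatingPoint.MiniFloat

/-! ## §4 Sharpness: a root just below a midpoint on the finest grid of `ψ` -/

/-- BELOW A MIDPOINT ON THE FINEST GRID OF `ψ`, CERTIFIED BY TWO STRICT INEQUALITIES. Records with
`quantum_φ = 2^d quantum_ψ`, `d ≥ 1`, nested ranges (`hmax`), `1 ≤ m_φ < m_ψ`; `μ = (2t+1)·2^g·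
quantum_φ/2` a midpoint of `φ` with `t` odd, `t < 2^(m_φ+1)`, in the finest zone (`g = 0`) or a
normal binade (`2^m_φ ≤ t`), upper neighbour `(t+1) 2^g` quanta in range. If a value `a ≥ 0` of
`φ` has `(μ - quantum_ψ/2)² < a < μ²` then the `ψ`-surrogate of `√a` is `μ - quantum_ψ/4`, so
`fl_ψ (√a) = μ` (every value of `ψ` is a multiple of `quantum_ψ`) and `fl_φ (μ) = (t+1) 2^g`
quanta (tie, odd lower neighbour) while `fl_φ (√a) = t 2^g` quanta: `¬ DRSqrt φ ψ`. [this packet] -/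
theorem not_drSqrt_of_fine_mid_below {φ ψ : Format} (hq1 : ψ.qexp + 1 ≤ φ.qexp)
    (hmax : φ.maxRat ≤ ψ.maxRat) (h1 : 1 ≤ φ.manBits) (hP : φ.manBits < ψ.manBits) {t g : ℕ}
    (ht : Odd t) (htlo : g = 0 ∨ 2 ^ φ.manBits ≤ t) (hthi : t < 2 ^ (φ.manBits + 1))
    (hu : (t + 1) * 2 ^ g ≤ φ.maxScaled) (a : MiniFloat φ) (ha0 : 0 ≤ a.toRat)
    (hhi : a.toRat < ((((2 * t + 1) * 2 ^ g : ℕ) : ℚ) * (φ.quantum / 2)) ^ 2)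
    (hlo : ((((2 * t + 1) * 2 ^ g : ℕ) : ℚ) * (φ.quantum / 2) - ψ.quantum / 2) ^ 2 < a.toRat) :
    ¬ DRSqrt φ ψ := by
  intro hDR
  have hQ := ψ.quantum_pos; have hQφ := φ.quantum_pos
  have hq : ψ.qexp ≤ φ.qexp := by omega
  set D := (φ.qexp - ψ.qexp).toNat with hDdef
  have hD1 : 1 ≤ D := by
    have : ((D : ℕ) : ℤ) = φ.qexp - ψ.qexp := Int.toNat_of_nonneg (by omega)
    omega
  obtain ⟨D', hD'⟩ := Nat.exists_eq_add_of_le' hD1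
  have hquant : φ.quantum = 2 ^ D * ψ.quantum := quantum_eq_two_pow_mul hq
  set ν : ℚ := ψ.quantum / 2 with hνdef
  have hν : 0 < ν := by positivity
  set μ : ℚ := (((2 * t + 1) * 2 ^ g : ℕ) : ℚ) * (φ.quantum / 2) with hμdef
  -- `μ = H ν = nψ quantum_ψ`
  obtain ⟨H, hH⟩ : ∃ H : ℕ, H = (2 * t + 1) * 2 ^ (g + D) := ⟨_, rfl⟩
  have hμH : μ = (H : ℚ) * ν := by
    rw [hμdef, hH, hquant, hνdef]; push_cast; ring
  have hH2 : 2 ≤ H := by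
    have h2 : 2 ^ 1 ≤ 2 ^ (g + D) := Nat.pow_le_pow_right (by norm_num) (by omega)
    rw [hH]
    calc 2 = 1 * 2 ^ 1 := by norm_num
      _ ≤ (2 * t + 1) * 2 ^ (g + D) := Nat.mul_le_mul (by omega) h2
  obtain ⟨nψ, hnψ⟩ : ∃ n : ℕ, n = (2 * t + 1) * 2 ^ (g + D') := ⟨_, rfl⟩
  have hμn : μ = (nψ : ℚ) * ψ.quantum := by
    rw [hμdef, hnψ, hquant, hD', pow_add, pow_one]; push_cast; ring
  have hrn : ψ.Representable nψ := by
    rw [hnψ]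
    refine representable_mul_pow ?_ ?_
    · calc 2 * t + 1 < 2 ^ (φ.manBits + 2) := by rw [pow_succ]; omega
        _ ≤ 2 ^ (ψ.manBits + 1) := Nat.pow_le_pow_right (by norm_num) (by omega)
    · -- range: `μ ≤ (t+1) 2^g quantum_φ ≤ maxRat φ ≤ maxRat ψ`
      have h2 : (((2 * t + 1) * 2 ^ (g + D') : ℕ) : ℚ) * ψ.quantum ≤
          (((t + 1) * 2 ^ g : ℕ) : ℚ) * φ.quantum := by
        rw [hquant, hD']; push_cast; simp only [pow_add, pow_one]; nlinarith [hQ,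
          (by positivity : (0:ℚ) ≤ 2 ^ g * 2 ^ D')]
      have h3 : (((t + 1) * 2 ^ g : ℕ) : ℚ) * φ.quantum ≤ φ.maxRat := by
        unfold Format.maxRat; exact mul_le_mul_of_nonneg_right (by exact_mod_cast hu) hQφ.le
      have h4 : (((2 * t + 1) * 2 ^ (g + D') : ℕ) : ℚ) * ψ.quantum ≤
          (ψ.maxScaled : ℚ) * ψ.quantum := by
        have := (h2.trans h3).trans hmax; unfold Format.maxRat at this; exact this
      exact_mod_cast le_of_mul_le_mul_right h4 hQ
  -- the `ψ`-cell of the root is `H - 1`, and the root is not its left end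
  have hh1 : sqrtCell ψ a.toRat + 1 ≤ H := by
    by_contra hc
    have hc' : (H : ℚ) ≤ sqrtCell ψ a.toRat := by
      exact_mod_cast (by omega : H ≤ sqrtCell ψ a.toRat)
    have h2 := sqrtCell_sq_le (φ := ψ) ha0
    rw [← hνdef] at h2
    have h3 : ((H : ℚ) * ν) ^ 2 ≤ ((sqrtCell ψ a.toRat : ℚ) * ν) ^ 2 :=
      pow_le_pow_left₀ (by positivity) (mul_le_mul_of_nonneg_right hc' hν.le) 2
    rw [← hμH] at h3
    linarith
  have hHm : ((H - 1 : ℕ) : ℚ) * ν = μ - ψ.quantum / 2 := by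
    rw [Nat.cast_sub (by omega), hμH, hνdef]; push_cast; ring
  have hh2 : H - 1 ≤ sqrtCell ψ a.toRat :=
    le_sqrtCell_of_sq_le (φ := ψ) (by rw [hHm]; exact hlo.le)
  have hcell : sqrtCell ψ a.toRat = H - 1 := by omega
  have hne : ((sqrtCell ψ a.toRat : ℚ) * (ψ.quantum / 2)) ^ 2 ≠ a.toRat := by
    rw [hcell, ← hνdef, hHm]; exact ne_of_lt hlo
  have hx : sqrtSurr ψ a.toRat = μ - ν / 2 := by
    rw [sqrtSurr_of_sq_ne hne, hcell, Nat.cast_sub (by omega), hμH]; push_cast; ring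
  -- the double rounding at `a`
  have e := hDR a ha0
  rw [← toRat_roundNE_sqrtSurr hq ha0] at e
  unfold roundNESqrt at e
  rw [hx] at e
  -- `fl_ψ (μ - ν/2) = μ`
  have hψ : (roundNE ψ (μ - ν / 2)).toRat = μ := by
    rw [hμn]
    refine toRat_roundNE_of_abs_lt_half hrn ?_
    rw [← hμn, show μ - ν / 2 - μ = -(ν / 2) by ring, abs_neg, abs_of_pos (by positivity), hνdef]
    linarith
  rw [hψ] at e
  -- `fl_φ (μ) = (t+1) 2^g` quanta but `fl_φ (μ - ν/2) = t 2^g` quanta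
  have hνq : ν / 2 < φ.quantum / 2 := by
    rw [hνdef, hquant, hD', pow_succ]
    have : (1:ℚ) ≤ 2 ^ D' := one_le_pow₀ (by norm_num)
    nlinarith
  rcases g with _ | k
  · -- finest zone `g = 0`
    have hμ0 : μ = ((2 * t + 1 : ℕ) : ℚ) * (φ.quantum / 2) := by rw [hμdef]; push_cast; ring
    have hup : (roundNE φ μ).toRat = ((t + 1 : ℕ) : ℚ) * φ.quantum := by
      rw [hμ0]; exact toRat_roundNE_fine_mid_odd h1 ht (by omega) (by simpa using hu)
    have hdn : (roundNE φ (μ - ν / 2)).toRat = (t : ℚ) * φ.quantum := by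
      refine toRat_roundNE_of_abs_lt_half (representable_of_lt_pow hthi ?_) ?_
      · have := hu; simp at this; omega
      · rw [hμ0, show ((2 * t + 1 : ℕ) : ℚ) * (φ.quantum / 2) - ν / 2 - (t : ℚ) * φ.quantum
          = φ.quantum / 2 - ν / 2 by push_cast; ring, abs_of_pos (by linarith)]
        linarith
    rw [hup, hdn] at e
    have : ((t + 1 : ℕ) : ℚ) = t := by exact_mod_cast mul_right_cancel₀ (ne_of_gt hQφ) e
    push_cast at this; linarith
  · -- a normal binade `g = k + 1`
    have htlo : 2 ^ φ.manBits ≤ t := htlo.resolve_left (by omega)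
    have hμk : μ = (((2 * t + 1) * 2 ^ k : ℕ) : ℚ) * φ.quantum := by
      rw [hμdef]; push_cast; ring
    have hu' : (t + 1) * 2 ^ (k + 1) ≤ φ.maxScaled := hu
    have hup : (roundNE φ μ).toRat = (((t + 1) * 2 ^ (k + 1) : ℕ) : ℚ) * φ.quantum := by
      rw [hμk]; exact toRat_roundNE_gmid_odd h1 ht htlo hthi hu'
    have hdn : (roundNE φ (μ - ν / 2)).toRat = ((t * 2 ^ (k + 1) : ℕ) : ℚ) * φ.quantum := by
      rw [hμk]
      refine toRat_roundNE_below_gmid htlo hthi hu' (by positivity) ?_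
      have : (1:ℚ) ≤ 2 ^ k := one_le_pow₀ (by norm_num)
      nlinarith
    rw [hup, hdn] at e
    have e' : (((t + 1) * 2 ^ (k + 1) : ℕ) : ℚ) = ((t * 2 ^ (k + 1) : ℕ) : ℚ) :=
      mul_right_cancel₀ (ne_of_gt hQφ) e
    have : (t + 1) * 2 ^ (k + 1) = t * 2 ^ (k + 1) := by exact_mod_cast e'
    have hk0 : 0 < 2 ^ (k + 1) := by positivity
    nlinarith

/-- LAW N-sqrt-U′ (THE DEPTH CLAUSE IS ATTAINED; record-generic failure family). Records with
`quantum_φ = 2^d quantum_ψ`, `d ≥ 1`, nested ranges, `1 ≤ m_φ < m_ψ`. At the binade `g ≥ 0` of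
`φ` (`g = 0`: the subnormal numbers and the first normal binade) take the midpoint
`μ = (2^(m+2) - 1)·2^g·quantum_φ/2 = 2^j - 2^(j-m-2)` and the operand
`a = μ² - 4^g quantum_φ²/4 = (2^(m+1) - 1)·2^e·quantum_φ`, `e = 2g + m + 1 + L_φ` (on the grid
iff `e ≥ 0`, i.e. `bias_φ ≤ 2g + 2`), both in range. If `g + d ≤ m + 2` then
`(μ - quantum_ψ/2)² < a < μ²`, so (`not_drSqrt_of_fine_mid_below`) `fl_φ (fl_ψ (√a)) =
2^(m+1+g) quantum_φ ≠ (2^(m+1) - 1) 2^g quantum_φ = fl_φ (√a)`: `¬ DRSqrt φ ψ`. With `g = 0`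
this refutes `DRSqrt` at every depth `d ≤ m + 2` for sources of bias `≤ 2`, so the depth `m + 3`
of THEOREM D-sqrt-U′ (`drSqrt_of_deep`) is attained; for bias `b ≥ 3` the family needs
`g ≥ ⌈(b-2)/2⌉` and refutes every `d ≤ m + 2 - ⌈(b-2)/2⌉`. [this packet] -/
theorem not_drSqrt_low_strip {φ ψ : Format} (hq1 : ψ.qexp + 1 ≤ φ.qexp)
    (hmax : φ.maxRat ≤ ψ.maxRat) (h1 : 1 ≤ φ.manBits) (hP : φ.manBits < ψ.manBits) {g e : ℕ}
    (he : (e : ℤ) = 2 * g + φ.manBits + 1 + φ.qexp)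
    (hae : (2 ^ (φ.manBits + 1) - 1) * 2 ^ e ≤ φ.maxScaled)
    (hu : 2 ^ (φ.manBits + 1) * 2 ^ g ≤ φ.maxScaled)
    (hG : g + (φ.qexp - ψ.qexp).toNat ≤ φ.manBits + 2) : ¬ DRSqrt φ ψ := by
  have hQ := ψ.quantum_pos; have hQφ := φ.quantum_pos
  have hq : ψ.qexp ≤ φ.qexp := by omega
  set D := (φ.qexp - ψ.qexp).toNat with hDdef
  have hD0 : ((D : ℕ) : ℤ) = φ.qexp - ψ.qexp := Int.toNat_of_nonneg (by omega)
  have hquant : φ.quantum = 2 ^ D * ψ.quantum := quantum_eq_two_pow_mul hq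
  -- the midpoint data `t = 2^(m+1) - 1`
  obtain ⟨t, ht2⟩ : ∃ t, 2 ^ (φ.manBits + 1) = t + 1 :=
    ⟨2 ^ (φ.manBits + 1) - 1, by have := Nat.one_le_two_pow (n := φ.manBits + 1); omega⟩
  have ht : Odd t := by
    refine Nat.odd_iff.mpr ?_
    have : (t + 1) % 2 = 0 := by rw [← ht2, pow_succ]; omega
    omega
  have htlo : 2 ^ φ.manBits ≤ t := by
    have : 2 ^ (φ.manBits + 1) = 2 * 2 ^ φ.manBits := by rw [pow_succ]; ring
    have h2 : 2 ≤ 2 ^ φ.manBits := le_trans (by norm_num) (Nat.pow_le_pow_right (by norm_num) h1)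
    omega
  have hthi : t < 2 ^ (φ.manBits + 1) := by omega
  have hts : 2 ^ (φ.manBits + 1) - 1 = t := by omega
  rw [hts] at hae
  -- the operand `a = t 2^e quantum_φ = t (t+1) 4^g quantum_φ²`
  obtain ⟨a, ha⟩ := exists_toRat_eq_natMul (representable_mul_pow (φ := φ) hthi hae)
  have ha0 : 0 ≤ a.toRat := by rw [ha]; positivity
  have hT : ((t : ℚ) + 1) = 2 ^ (φ.manBits + 1) := by exact_mod_cast ht2.symm
  have h2e : (2:ℚ) ^ e * φ.quantum = 2 ^ (2 * g) * 2 ^ (φ.manBits + 1) * φ.quantum ^ 2 := by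
    unfold Format.quantum
    rw [← zpow_natCast (2:ℚ) e, he, sq, ← zpow_natCast, ← zpow_natCast]
    push_cast
    simp only [zpow_add₀ (two_ne_zero (α := ℚ))]
    ring
  have haq : a.toRat = (t : ℚ) * (t + 1) * 2 ^ (2 * g) * φ.quantum ^ 2 := by
    rw [ha, hT]; push_cast; rw [mul_assoc, h2e]; ring
  -- the two strict inequalities
  have hX : (2:ℚ) ^ (g + D) ≤ 2 * (t + 1) := by
    rw [hT, ← pow_succ']; exact pow_le_pow_right₀ (by norm_num) (by omega)
  have hX1 : (2:ℚ) ≤ 2 ^ (g + D) := by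
    have hD1 : 1 ≤ g + D := by omega
    calc (2:ℚ) = 2 ^ 1 := by norm_num
      _ ≤ 2 ^ (g + D) := pow_le_pow_right₀ (by norm_num) hD1
  have ht3 : (3:ℚ) ≤ t := by
    have h4 : 2 ^ 2 ≤ 2 ^ (φ.manBits + 1) := Nat.pow_le_pow_right (by norm_num) (by omega)
    exact_mod_cast (by omega : 3 ≤ t)
  refine not_drSqrt_of_fine_mid_below hq1 hmax h1 hP ht (Or.inr htlo) hthi
    (by rw [ht2] at hu; exact hu) a ha0 ?_ ?_
  · -- `a < μ²`: `4 t (t+1) < (2t+1)²`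
    rw [haq]; push_cast
    have h4 : (0:ℚ) < 2 ^ (2 * g) * φ.quantum ^ 2 := by positivity
    rw [show (2:ℚ) ^ (2 * g) = 2 ^ g * 2 ^ g by rw [two_mul, pow_add]] at h4 ⊢
    nlinarith [h4]
  · -- `(μ - quantum_ψ/2)² < a`: `X² + 1 < 2 (2t+1) X` for `X = 2^(g+d) ≤ 2^(m+2)`
    rw [haq, hquant]; push_cast
    set X : ℚ := 2 ^ (g + D) with hXdef
    have hμX : (2 * (t : ℚ) + 1) * 2 ^ g * (2 ^ D * ψ.quantum / 2) - ψ.quantum / 2 =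
        ((2 * t + 1) * X - 1) * (ψ.quantum / 2) := by rw [hXdef, pow_add]; ring
    have haX : (t : ℚ) * (t + 1) * 2 ^ (2 * g) * (2 ^ D * ψ.quantum) ^ 2 =
        4 * t * (t + 1) * X ^ 2 * (ψ.quantum / 2) ^ 2 := by
      rw [hXdef, two_mul, pow_add, pow_add]; ring
    rw [hμX, haX, mul_pow]
    have hν2 : (0:ℚ) < (ψ.quantum / 2) ^ 2 := by positivity
    have hkey : ((2 * (t:ℚ) + 1) * X - 1) ^ 2 < 4 * t * (t + 1) * X ^ 2 := by
      nlinarith [hX, hX1, ht3]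
    exact mul_lt_mul_of_pos_right hkey hν2

/-! ## §5 The law: parameter tests and the exact depth for sources of bias at most two -/

/-- THE SHALLOW HALF ON THE BIAS: records `quantum_φ = 2^d quantum_ψ`, `d ≥ 1`, nested ranges,
`1 ≤ m_φ < m_ψ`, a binade `g` with `bias_φ ≤ 2g + 2` (the operand `(2^(m+1) - 1) 2^(2g+2-bias_φ)`
quanta of the family is on the grid) and operand and upper neighbour `2^(m+1+g)` quanta in range:
`g + d ≤ m + 2 ⇒ ¬ DRSqrt φ ψ`. [this packet] -/
theorem not_drSqrt_of_shallow {φ ψ : Format} (hq1 : ψ.qexp + 1 ≤ φ.qexp)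
    (hmax : φ.maxRat ≤ ψ.maxRat) (h1 : 1 ≤ φ.manBits) (hP : φ.manBits < ψ.manBits) {g : ℕ}
    (hb : φ.bias ≤ 2 * g + 2)
    (hae : (2 ^ (φ.manBits + 1) - 1) * 2 ^ (2 * g + 2 - φ.bias) ≤ φ.maxScaled)
    (hu : 2 ^ (φ.manBits + 1) * 2 ^ g ≤ φ.maxScaled)
    (hG : g + (φ.qexp - ψ.qexp).toNat ≤ φ.manBits + 2) : ¬ DRSqrt φ ψ :=
  not_drSqrt_low_strip hq1 hmax h1 hP (e := 2 * g + 2 - φ.bias)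
    (by unfold Format.qexp; push_cast [Nat.cast_sub hb]; ring) hae hu hG

/-- THEOREM D-sqrt-U′ IS EXACT IN THE DEPTH for sources of bias `≤ 2` (e2m1, e2m3, …): for records
`F_φ ⊆ F_ψ`, `P_ψ ≥ 2P_φ + 2`, `m_φ ≥ 1`, `bias_φ ≤ 2`, the values `(2^(m+1) - 1) 2^(2-bias_φ)` and
`2^(m+1)` quanta in range, and `quantum_φ = 2^d quantum_ψ` with `d ≥ 1`:
`DRSqrt φ ψ ↔ d ≥ m_φ + 3`. [this packet] -/
theorem drSqrt_iff_deep {φ ψ : Format} (hE : embedsTest φ ψ = true)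
    (hm : 2 * φ.manBits + 3 ≤ ψ.manBits) (h1 : 1 ≤ φ.manBits) (hq1 : ψ.qexp + 1 ≤ φ.qexp)
    (hb : φ.bias ≤ 2) (hR : (2 ^ (φ.manBits + 1) - 1) * 2 ^ (2 - φ.bias) ≤ φ.maxScaled)
    (hu : 2 ^ (φ.manBits + 1) ≤ φ.maxScaled) :
    DRSqrt φ ψ ↔ ψ.qexp + φ.manBits + 3 ≤ φ.qexp := by
  refine ⟨fun h => ?_, drSqrt_of_deep hE hm h1⟩
  by_contra hd
  obtain ⟨zM, hzM⟩ := exists_toRat_eq_maxRat_of_test hE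
  have hmax : φ.maxRat ≤ ψ.maxRat := hzM ▸ (le_abs_self _).trans (abs_toRat_le_maxRat zM)
  refine not_drSqrt_of_shallow (g := 0) hq1 hmax h1 (by omega) (by omega) (by simpa using hR)
    (by simpa using hu) ?_ h
  have : (((φ.qexp - ψ.qexp).toNat : ℕ) : ℤ) = φ.qexp - ψ.qexp := Int.toNat_of_nonneg (by omega)
  omega

/-- Parameter test of LAW N-sqrt-U′ at binade `g` (`not_drSqrt_of_shallow`). [this packet] -/
def drSqrtShallowTest (φ ψ : Format) (g : ℕ) : Bool :=
  decide (ψ.qexp + 1 ≤ φ.qexp) && decide (φ.maxRat ≤ ψ.maxRat) && decide (1 ≤ φ.manBits) &&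
    decide (φ.manBits < ψ.manBits) && decide (φ.bias ≤ 2 * g + 2) &&
    decide ((2 ^ (φ.manBits + 1) - 1) * 2 ^ (2 * g + 2 - φ.bias) ≤ φ.maxScaled) &&
    decide (2 ^ (φ.manBits + 1) * 2 ^ g ≤ φ.maxScaled) &&
    decide (g + (φ.qexp - ψ.qexp).toNat ≤ φ.manBits + 2)

/-- Soundness of the shallow test at binade `g`. -/
theorem not_drSqrt_of_shallowTest {φ ψ : Format} {g : ℕ} (h : drSqrtShallowTest φ ψ g = true) :
    ¬ DRSqrt φ ψ := by
  simp only [drSqrtShallowTest, Bool.and_eq_true, decide_eq_true_eq] at h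
  obtain ⟨⟨⟨⟨⟨⟨⟨hq1, hmax⟩, h1⟩, hP⟩, hb⟩, hae⟩, hu⟩, hG⟩ := h
  exact not_drSqrt_of_shallow hq1 hmax h1 hP hb hae hu hG

/-- LAW N-sqrt-U′ at some binade `g ≤ m + 2`. [this packet] -/
def drSqrtShallowAny (φ ψ : Format) : Bool :=
  (List.range (φ.manBits + 3)).any (drSqrtShallowTest φ ψ)

/-- Soundness of the shallow test over the binades `g ≤ m + 2`. -/
theorem not_drSqrt_of_shallowAny {φ ψ : Format} (h : drSqrtShallowAny φ ψ = true) :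
    ¬ DRSqrt φ ψ := by
  simp only [drSqrtShallowAny, List.any_eq_true] at h
  obtain ⟨g, -, hg⟩ := h
  exact not_drSqrt_of_shallowTest hg

end Summit.Ventures.CertifiedArithmetic
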